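import Literature.AnabelianGeometry.SemiGraphs.TemperedAnabelian
import Mathlib.NumberTheory.Padics.Complex
import Mathlib.GroupTheory.Commutator.Basic
import Mathlib.GroupTheory.Index
import Mathlib.Data.PNat.Basic
import HarnessLib

/-!
# [EtTh] §1: the setting — a once-punctured Tate curve, its tempered fundamental group, the theta
# quotients, coverings and fields of pp. 11–15, 17

Mochizuki, *The étale theta function and its Frobenioid-theoretic manifestations*, Publ. RIMS **45**
(2009) 227–349, §1, the un-numbered setting of PRIMS PDF pp. 11–15 (printed 237–241) and the "double"
objects of p. 17 [cite: MochizukiEtTh2009, §1 p.11]. Layer L2 of the abc-iut cell; the L2 ROOT file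
(plan/L2/ASSIGNMENTS.md §C.1). Seat abc-iut-L2-t1. v3 (supersedes p403875/p404211): per the review of
p404211, the setting now EXTENDS the tree's tempered-curve interface
`Literature.AnabelianGeometry.SemiGraphs.TemperedCurve p` ([SemiAnbd] §6; base field
`K ⊆ ℚ̄_p = PadicAlgCl p` an actual finite extension of `ℚ_p`, tempered group `PiTemp` with
augmentation to `G_{ℚ_p}` of image `G_K`, profinite completion `toHat : PiTemp →ₜ* PiHat` with
`IsProfiniteCompletion`, cusps and decomposition groups) instead of a local stub; consequently the
Galois groups of `K_N`, `J_N`, `K̈ = K₂`, `J̈_N` and the rings of integers are DEFINITIONS (inside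
`ℚ̄_p` with its `p`-adic norm, Mathlib `PadicAlgCl`), not transcribed data.

What remains DATA with `Prop` fields quoting print (André's tempered `π₁`, formal schemes and log
structures are not in Mathlib, plan/FOUNDATIONS.md rows 13–14): the `q`-parameter `q_X ∈ K`
(p. 13), the surjection `Π^tp_X ↠ Z` (p. 12), the theta quotients
`Π^tp_X ↠ (Π^tp_X)^Θ ↠ (Π^tp_X)^ell` with their printed kernels (p. 12), and the coverings `Y_N → Y`,
`Z_N → Y_N` as open subgroups `Π^tp_{Y_N} ⊇ Π^tp_{Z_N}` with their printed Galois groups (pp. 13–14);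
derived objects (`Π^tp_Y`, `Ÿ = Y₂`, `Ÿ_N`, `Z̈_N`, `Δ_Θ`, `O^×_K̈`, …) are `def`s. No field asserts
that such data EXIST for an actual curve; §1's statements (sibling files) are predicates on this
structure, guarded by `ThetaSetting.IsEtThOrigin` (which now carries the printed, statable
hypothesis "`Δ_X` is a profinite free group on 2 generators", p. 12).

Deliberately NOT here (sibling files): line bundles / theta trivialisations (Prop. 1.1, Lem. 1.2),
cohomology and the étale theta class (Prop. 1.3 ff.), the curves `Ẍ, C, Ẋ, Ċ` (Def. 1.7 ff.).
Deferred TRANSCRIPTIONS (listed so nothing is silently dropped): `Δ_Θ ≅ Ẑ(1)` and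
`(Δ^tp_Y)^ell ≅ Ẑ(1)` as `G_K`-modules (the Tate twist), `Pic(Y_N) ≅ ℤ^ℤ`, `Γ(Y_N, O_{Y_N}) = O_{K_N}`
(p. 14), the special-fibre descriptions (pp. 12–13). HONEST FRAMING: [EtTh] is refereed; nothing in it
is asserted here — typed ≠ proved; no side is taken on any disputed claim.
-/

noncomputable section

namespace Literature.AnabelianGeometry.EtaleTheta

open Literature.AnabelianGeometry.SemiGraphs

variable {p : ℕ} [Fact p.Prime]

/-! ### The fields `K_N`, `J_N`, `K̈_N`, `J̈_N` inside `ℚ̄_p` (pp. 13–14, 17) — definitions -/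

/-- `K_N := K(ζ_N, q_X^{1/N}) ⊆ K̄` "— where `ζ_N` is a primitive `N`-th root of unity" (p. 13), as the
subfield of `ℚ̄_p` generated over `K` by ALL `N`-th roots of unity and ALL `N`-th roots of `q`
(choice-free; equal to the printed field since `ζ_N ∈ K_N`). [cite: MochizukiEtTh2009, §1 p.13] -/
def fieldKN (K : IntermediateField ℚ_[p] (PadicAlgCl p)) (q : PadicAlgCl p) (N : ℕ+) :
    IntermediateField ℚ_[p] (PadicAlgCl p) :=
  IntermediateField.adjoin ℚ_[p] ((K : Set (PadicAlgCl p)) ∪ {x | x ^ (N : ℕ) = 1 ∨ x ^ (N : ℕ) = q})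

/-- `J_N := K_N(a^{1/N})_{a ∈ K_N} ⊆ K̄` (p. 14): `K_N` with all `N`-th roots of all its elements adjoined.
[cite: MochizukiEtTh2009, §1 p.14] -/
def fieldJN (K : IntermediateField ℚ_[p] (PadicAlgCl p)) (q : PadicAlgCl p) (N : ℕ+) :
    IntermediateField ℚ_[p] (PadicAlgCl p) :=
  IntermediateField.adjoin ℚ_[p]
    ((fieldKN K q N : Set (PadicAlgCl p)) ∪ {x | x ^ (N : ℕ) ∈ fieldKN K q N})

/-- `J̈_N := K̈_N(a^{1/N})_{a ∈ K̈_N}` with "`K̈_N := K_{2N}`" (p. 17). [cite: MochizukiEtTh2009, §1 p.17] -/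
def fieldJddN (K : IntermediateField ℚ_[p] (PadicAlgCl p)) (q : PadicAlgCl p) (N : ℕ+) :
    IntermediateField ℚ_[p] (PadicAlgCl p) :=
  IntermediateField.adjoin ℚ_[p]
    ((fieldKN K q (2 * N) : Set (PadicAlgCl p)) ∪ {x | x ^ (N : ℕ) ∈ fieldKN K q (2 * N)})

/-- "`Δ_X` is a profinite free group on 2 generators" (p. 12), for a topological group `P`: there are
`a, b ∈ P` such that every pair of elements of a finite discrete group is the image of `(a, b)` under
a unique continuous homomorphism (the universal property against finite groups, which characterises
the free profinite group of rank 2 among profinite groups). [cite: MochizukiEtTh2009, §1 p.12] -/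
def IsFreeProfiniteOnTwo (P : Type*) [Group P] [TopologicalSpace P] : Prop :=
  CompactSpace P ∧ T2Space P ∧ TotallyDisconnectedSpace P ∧
  ∃ a b : P, ∀ (Q : Type) [Group Q] [Finite Q] [TopologicalSpace Q] [DiscreteTopology Q]
    (x y : Q), ∃! f : P →ₜ* Q, f a = x ∧ f b = y

/-! ### The theta setting -/

/-- **The [EtTh] §1 theta setting of type `(1,1)`** (PRIMS PDF pp. 11–15, 17) over the tree's
tempered-curve interface `SemiGraphs.TemperedCurve p` (`K ⊆ ℚ̄_p` finite over `ℚ_p`; `Π^tp_X = PiTemp`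
with `aug : Π^tp_X → G_{ℚ_p}` of image `G_K`; `Δ^tp_X = DeltaTemp = Ker aug`; profinite completion
`toHat : Π^tp_X → Π_X = PiHat`, `Δ_X = DeltaHat`): "`X^log` a stable log curve of type `(1,1)` … the
special fiber of `X` is singular and split" (p. 11) supplies, as DATA with printed properties, the
`q`-parameter (p. 13), the surjection `Π^tp_X ↠ Z` (p. 12; its sign fixes the "orientation" of p. 18),
the theta quotients (p. 12), and the coverings `Y_N`, `Z_N` (pp. 13–14). [cite: MochizukiEtTh2009, §1 p.11] -/
structure ThetaSetting (p : ℕ) [Fact p.Prime] extends TemperedCurve p where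
  -- ### the q-parameter and K̈ (p. 13, p. 17)
  /-- "`q_X ∈ O_K` … the `q`-parameter of the underlying elliptic curve of `X^log`" (p. 13), as an
  element of `K̄ = ℚ̄_p` … -/
  qX : PadicAlgCl p
  /-- … lying in `K` … -/
  qX_mem : qX ∈ K
  /-- … in the maximal ideal of `O_K` (the special fibre is singular, p. 11: `|q_X| < 1`) … -/
  norm_qX_lt_one : ‖qX‖ < 1
  /-- … and nonzero (the generic fibre is smooth, p. 11). Tate uniformisation (`E_K ≅` the tree's
  `tateCurve q_X`) is a FACT of the Tate-curve API (plan/FOUNDATIONS.md row 8), unused in §1. -/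
  qX_ne_zero : qX ≠ 0
  /-- A square root `q̈ = q_X^{1/2}` of `q_X` in `K̄` (p. 17: `K̈ = K(ζ₂, q_X^{1/2})`; the variable of the
  series of Prop. 1.4 — which does not depend on the choice, `q̈` entering through `q̈^{n(n+1)}`). -/
  sqrtqX : PadicAlgCl p
  /-- `(q_X^{1/2})² = q_X`. -/
  sqrtqX_sq : sqrtqX ^ 2 = qX
  -- ### the surjection Π^tp_X ↠ Z and the theta quotients (p. 12)
  /-- "the universal graph-covering of the dual graph of this special fiber determines [up to
  composition with an element of `Aut(Z) = {±1}`] a natural surjection `Π^tp_X ↠ Z`" (p. 12), `Z ≅ ℤ`;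
  DATA valued in `ℤ` — the sign is the "orientation on the dual graph of the special fiber of `Y`"
  chosen on p. 18, so that irreducible components are "labeled by elements of `Z`" `= ℤ`. -/
  toZ : PiTemp →* Multiplicative ℤ
  /-- `Π^tp_X ↠ Z` is surjective (p. 12). -/
  toZ_surjective : Function.Surjective toZ
  /-- `Z` is discrete and the surjection continuous: `Π^tp_Y = Ker` is open ("the discreteness of the
  topological group `Z`", proof of Thm. 1.6 (i), p. 24). -/
  isOpen_ker_toZ : IsOpen (toZ.ker : Set PiTemp)
  /-- `Y → X` is geometric: already `Δ^tp_X ↠ Z` is onto ("`Δ^tp_X/Δ^tp_Y ≅ Z`", pp. 16, 28). -/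
  toZ_delta_surjective : Function.Surjective (toZ.restrict aug.toMonoidHom.ker)
  /-- `(Π^tp_X)^Θ`: "we shall write `Π^tp_X ↠ (Π^tp_X)^Θ ↠ (Π^tp_X)^ell` for the quotients whose kernels
  are the kernels of the quotients `Δ^tp_X ↠ (Δ^tp_X)^Θ ↠ (Δ^tp_X)^ell`", themselves "induced by the
  quotients `Δ_X ↠ Δ^Θ_X ↠ Δ^ell_X`" (p. 12) — a topological group. -/
  GtpTheta : Type
  [instGroupGtpTheta : Group GtpTheta]
  [instTopGtpTheta : TopologicalSpace GtpTheta]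
  [instTopGroupGtpTheta : IsTopologicalGroup GtpTheta]
  /-- The quotient map `Π^tp_X ↠ (Π^tp_X)^Θ` (p. 12). -/
  toTheta : PiTemp →* GtpTheta
  /-- `Π^tp_X ↠ (Π^tp_X)^Θ` is continuous … -/
  continuous_toTheta : Continuous toTheta
  /-- … and surjective (p. 12). -/
  toTheta_surjective : Function.Surjective toTheta
  /-- Its kernel is induced by `Δ_X ↠ Δ^Θ_X := Δ_X/[Δ_X, [Δ_X, Δ_X]]` (p. 12): the pull-back along
  `Π^tp_X → Π_X` of the closed subgroup topologically generated by `[Δ_X, [Δ_X, Δ_X]]`,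
  `Δ_X = DeltaHat` (it lies in `Δ^tp_X`: `EtaleThetaClass.ker_toTheta_le_deltaTemp`). -/
  ker_toTheta : toTheta.ker =
    (Subgroup.topologicalClosure
      ⁅⁅toTemperedCurve.DeltaHat, toTemperedCurve.DeltaHat⁆, toTemperedCurve.DeltaHat⁆).comap
      toHat.toMonoidHom
  /-- `(Π^tp_X)^ell` (p. 12), a topological group. -/
  GtpEll : Type
  [instGroupGtpEll : Group GtpEll]
  [instTopGtpEll : TopologicalSpace GtpEll]
  [instTopGroupGtpEll : IsTopologicalGroup GtpEll]
  /-- The quotient map `(Π^tp_X)^Θ ↠ (Π^tp_X)^ell` (p. 12). -/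
  thetaToEll : GtpTheta →* GtpEll
  /-- continuous … -/
  continuous_thetaToEll : Continuous thetaToEll
  /-- … and surjective (p. 12). -/
  thetaToEll_surjective : Function.Surjective thetaToEll
  /-- The kernel of `Π^tp_X ↠ (Π^tp_X)^ell` is induced by `Δ_X ↠ Δ^ell_X := Δ^ab_X = Δ_X/[Δ_X, Δ_X]`
  (p. 12): the pull-back of the closure of `[Δ_X, Δ_X]` in `Π_X`. -/
  ker_toEll : (thetaToEll.comp toTheta).ker =
    (⁅toTemperedCurve.DeltaHat, toTemperedCurve.DeltaHat⁆.topologicalClosure).comap toHat.toMonoidHom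
  /-- `Δ_Θ` "(`≅ Ẑ(1)`)", the image of `∧² Δ^ell_X` in `Δ^Θ_X` (p. 12) = the kernel of
  `(Π^tp_X)^Θ ↠ (Π^tp_X)^ell`, is commutative … -/
  ker_thetaToEll_comm : ∀ x ∈ thetaToEll.ker, ∀ y ∈ thetaToEll.ker, x * y = y * x
  /-- … and central in `(Δ^tp_X)^Θ` (`Δ^Θ_X = Δ_X/[Δ_X,[Δ_X,Δ_X]]` is a central extension, p. 12). -/
  ker_thetaToEll_central :
    ∀ x ∈ thetaToEll.ker, ∀ y ∈ (aug.toMonoidHom.ker).map toTheta, x * y = y * x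
  -- ### the coverings Y_N → Y and Z_N → Y_N (pp. 13–14) through their tempered fundamental groups
  /-- `Π^tp_{Y_N} ⊆ Π^tp_X`: "… a Galois covering `Y_N → Y` such that the resulting surjection
  `Π^tp_Y ↠ Gal(Y_N/Y)`, whose kernel we denote by `Π^tp_{Y_N}`, induces a natural exact sequence
  `1 → (Δ^tp_Y)^ell ⊗ ℤ/Nℤ → Gal(Y_N/Y) → Gal(K_N/K) → 1`" (p. 13). -/
  GtpYN : ℕ+ → Subgroup PiTemp
  /-- `Y₁ = Y` (p. 14 "`s₁ ∈ Γ(Y = Y₁, L₁)`"): `Π^tp_{Y₁} = Π^tp_Y = Ker(Π^tp_X ↠ Z)`. -/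
  GtpYN_one : GtpYN 1 = toZ.ker
  /-- `Y_N → Y`: `Π^tp_{Y_N} ⊆ Π^tp_Y` (p. 13). -/
  GtpYN_le : ∀ N, GtpYN N ≤ toZ.ker
  /-- The image of `Π^tp_{Y_N}` in `G_{ℚ_p}` is `G_{K_N}` (exactness of
  `1 → (Δ^tp_Y)^ell ⊗ ℤ/Nℤ → Gal(Y_N/Y) → Gal(K_N/K) → 1`, p. 13). -/
  map_aug_GtpYN : ∀ N, (GtpYN N).map aug.toMonoidHom = (fieldKN K qX N).fixingSubgroup
  /-- `Π^tp_{Y_N}` is normal in `Π^tp_X` ("`Gal(Y_N/X)`", p. 14; the defining image "is stabilized by the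
  conjugation action of `Π^tp_X`", p. 13). -/
  GtpYN_normal : ∀ N, (GtpYN N).Normal
  /-- `Π^tp_{Y_N}` is open in `Π^tp_X`. -/
  isOpen_GtpYN : ∀ N, IsOpen (GtpYN N : Set PiTemp)
  /-- "`Y_M → Y` may be regarded as a subcovering of `Y_N → Y`" for `M ∣ N` (p. 18). -/
  GtpYN_anti : ∀ M N : ℕ+, (M : ℕ) ∣ N → GtpYN N ≤ GtpYN M
  /-- The geometric Galois group of `Y_N → Y` is `(Δ^tp_Y)^ell ⊗ ℤ/Nℤ`, `(Δ^tp_Y)^ell ≅ Ẑ(1)` (p. 13;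
  "`Δ^tp_Y/Δ^tp_{Y_N} ≅ ℤ/Nℤ(1)`", p. 16) — recorded: `Δ^tp_{Y_N}` has index `N` in `Δ^tp_Y`. -/
  relIndex_deltaYN : ∀ N : ℕ+,
    (GtpYN N ⊓ aug.toMonoidHom.ker).relIndex (toZ.ker ⊓ aug.toMonoidHom.ker) = N
  /-- `Π^tp_{Z_N} ⊆ Π^tp_X`: "… a Galois covering `Z_N → Y_N` such that the resulting surjection
  `Π^tp_{Y_N} ↠ Gal(Z_N/Y_N)`, whose kernel we denote by `Π^tp_{Z_N}`, induces a natural exact sequence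
  `1 → Δ_Θ ⊗ ℤ/Nℤ → Gal(Z_N/Y_N) → Gal(J_N/K_N) → 1`" (p. 14). -/
  GtpZN : ℕ+ → Subgroup PiTemp
  /-- `Z_N → Y_N`: `Π^tp_{Z_N} ⊆ Π^tp_{Y_N}` (p. 14). -/
  GtpZN_le : ∀ N, GtpZN N ≤ GtpYN N
  /-- The image of `Π^tp_{Z_N}` in `G_{ℚ_p}` is `G_{J_N}` (exactness, p. 14). -/
  map_aug_GtpZN : ∀ N, (GtpZN N).map aug.toMonoidHom = (fieldJN K qX N).fixingSubgroup
  /-- `Π^tp_{Z_N}` is normal in `Π^tp_X` ("`Π^tp_X/Π^tp_{Z_N} = Gal(Z_N/X)`", Prop. 1.1 (ii), statement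
  p. 15, proof p. 16). -/
  GtpZN_normal : ∀ N, (GtpZN N).Normal
  /-- `Π^tp_{Z_N}` is open in `Π^tp_X` ("`Z_N` is finite over `Y`", p. 14). -/
  isOpen_GtpZN : ∀ N, IsOpen (GtpZN N : Set PiTemp)
  /-- "`Z_M → Y` may be regarded as a subcovering of `Z_N → Y`" for `M ∣ N` (p. 18). -/
  GtpZN_anti : ∀ M N : ℕ+, (M : ℕ) ∣ N → GtpZN N ≤ GtpZN M
  /-- The geometric Galois group of `Z_N → Y_N` is `Δ_Θ ⊗ ℤ/Nℤ` (p. 14; p. 20 "the natural isomorphism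
  `Δ^tp_{Ÿ_N}/Δ^tp_{Z̈_N} ≅ Δ_Θ ⊗ ℤ/Nℤ`") — recorded: `Δ^tp_{Z_N}` has index `N` in `Δ^tp_{Y_N}` … -/
  relIndex_deltaZN : ∀ N : ℕ+,
    (GtpZN N ⊓ aug.toMonoidHom.ker).relIndex (GtpYN N ⊓ aug.toMonoidHom.ker) = N
  /-- … and `Z_N` is cut out inside the theta quotient `(Π^tp_{Y_N})^Θ/N·(Δ^tp_Y)^Θ` (p. 14):
  `Π^tp_{Z_N} ⊇ Ker(Π^tp_{Y_N} → (Π^tp_X)^Θ)`. -/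
  ker_toTheta_le_GtpZN : ∀ N, toTheta.ker ⊓ GtpYN N ≤ GtpZN N

attribute [instance] ThetaSetting.instGroupGtpTheta ThetaSetting.instTopGtpTheta
  ThetaSetting.instTopGroupGtpTheta ThetaSetting.instGroupGtpEll ThetaSetting.instTopGtpEll
  ThetaSetting.instTopGroupGtpEll

namespace ThetaSetting

variable (D : ThetaSetting p)

/-! ### Derived objects (definitions only; pp. 12–14, 17, 19–21) -/

/-- `Π^tp_X` under its printed name. [cite: MochizukiEtTh2009, §1 p.11] -/
abbrev Gtp : Type := D.PiTemp

/-- `Δ^tp_X = Ker(Π^tp_X → G_K)` ("the geometric tempered fundamental group", p. 12) — the tree's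
`TemperedCurve.DeltaTemp`. [cite: MochizukiEtTh2009, §1 p.12] -/
abbrev Dtp : Subgroup D.PiTemp := D.DeltaTemp

/-- `Π^tp_Y := Ker(Π^tp_X ↠ Z)`, "an infinite étale covering `Y^log → X^log`" (p. 12).
[cite: MochizukiEtTh2009, §1 p.12] -/
def GtpY : Subgroup D.PiTemp := D.toZ.ker

/-- `Δ^tp_Y := Π^tp_Y ∩ Δ^tp_X` (p. 12). [cite: MochizukiEtTh2009, §1 p.12] -/
def DtpY : Subgroup D.PiTemp := D.GtpY ⊓ D.DeltaTemp

/-- `Δ^tp_{Y_N} := Π^tp_{Y_N} ∩ Δ^tp_X` (p. 13). [cite: MochizukiEtTh2009, §1 p.13] -/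
def DtpYN (N : ℕ+) : Subgroup D.PiTemp := D.GtpYN N ⊓ D.DeltaTemp

/-- `Δ^tp_{Z_N} := Π^tp_{Z_N} ∩ Δ^tp_X` (p. 14). [cite: MochizukiEtTh2009, §1 p.14] -/
def DtpZN (N : ℕ+) : Subgroup D.PiTemp := D.GtpZN N ⊓ D.DeltaTemp

/-- `Δ_Θ ⊆ (Π^tp_X)^Θ`: the kernel of `(Π^tp_X)^Θ ↠ (Π^tp_X)^ell`, "`(Ẑ(1) ≅) Δ_Θ`", "the image of
`∧² Δ^ell_X` in `Δ^Θ_X`" (p. 12; the `Π`- and `Δ`-quotient kernels agree by definition).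
[cite: MochizukiEtTh2009, §1 p.12] -/
def DeltaTheta : Subgroup D.GtpTheta := D.thetaToEll.ker

/-- `(Π^tp_Y)^Θ`, the image of `Π^tp_Y` in `(Π^tp_X)^Θ` (p. 12). [cite: MochizukiEtTh2009, §1 p.12] -/
def GtpYTheta : Subgroup D.GtpTheta := D.GtpY.map D.toTheta

/-- `(Δ^tp_Y)^Θ`, the image of `Δ^tp_Y` in `(Π^tp_X)^Θ`; "a natural exact sequence of abelian profinite
groups `1 → Δ_Θ → (Δ^tp_Y)^Θ → (Δ^tp_Y)^ell → 1`" (p. 12). [cite: MochizukiEtTh2009, §1 p.12] -/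
def DtpYTheta : Subgroup D.GtpTheta := D.DtpY.map D.toTheta

/-- `G_{K_N} = Gal(K̄/K_N) ≤ G_{ℚ_p}` for `K_N = K(ζ_N, q_X^{1/N})` (p. 13). [cite: MochizukiEtTh2009, §1 p.13] -/
def GKN (N : ℕ+) : Subgroup (GQp p) := (fieldKN D.K D.qX N).fixingSubgroup

/-- `G_{J_N} ≤ G_{ℚ_p}` for `J_N = K_N(a^{1/N})_{a ∈ K_N}` (p. 14). [cite: MochizukiEtTh2009, §1 p.14] -/
def GJN (N : ℕ+) : Subgroup (GQp p) := (fieldJN D.K D.qX N).fixingSubgroup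

/-- `K̈ := K̈₁ = J̈₁ = K₂ = K(ζ₂, q_X^{1/2})` (pp. 13, 17), a subfield of `ℚ̄_p`. [cite: MochizukiEtTh2009, §1 p.17] -/
def Kdd : IntermediateField ℚ_[p] (PadicAlgCl p) := fieldKN D.K D.qX 2

/-- `G_K̈ := Gal(K̄/K̈) = G_{K₂}` (p. 17). [cite: MochizukiEtTh2009, §1 p.17] -/
def GKdd : Subgroup (GQp p) := D.GKN 2

/-- `G_{K̈_N} := G_{K_{2N}}` ("`K̈_N := K_{2N}`", p. 17). [cite: MochizukiEtTh2009, §1 p.17] -/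
def GKddN (N : ℕ+) : Subgroup (GQp p) := D.GKN (2 * N)

/-- `G_{J̈_N} ≤ G_{ℚ_p}` for "`J̈_N := K̈_N(a^{1/N})_{a ∈ K̈_N}`" (p. 17). [cite: MochizukiEtTh2009, §1 p.17] -/
def GJddN (N : ℕ+) : Subgroup (GQp p) := (fieldJddN D.K D.qX N).fixingSubgroup

/-- `Π^tp_{Ÿ_N}`: "`Ÿ_N := Y_{2N} ×_{K̈_N} J̈_N`" (p. 17, generic fibres; formal model
`Y_{2N} ×_{O_{K̈_N}} O_{J̈_N}`): `Π^tp_{Y_{2N}}` restricted to `G_{J̈_N}`. [cite: MochizukiEtTh2009, §1 p.17] -/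
def GtpYddN (N : ℕ+) : Subgroup D.PiTemp := D.GtpYN (2 * N) ⊓ (D.GJddN N).comap D.aug.toMonoidHom

/-- `Π^tp_Ÿ`, "`Ÿ := Ÿ₁ = Y₂`" (p. 17): the double covering of `Y` on which `Θ̈` lives.
[cite: MochizukiEtTh2009, §1 p.17] -/
def GtpYdd : Subgroup D.PiTemp := D.GtpYddN 1

/-- `Π^tp_{Z̈_N}`: "`Z̈_N` for the composite of the coverings `Ÿ_N`, `Z_N` of `Y_N`" (p. 17).
[cite: MochizukiEtTh2009, §1 p.17] -/
def GtpZddN (N : ℕ+) : Subgroup D.PiTemp := D.GtpYddN N ⊓ D.GtpZN N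

/-- `Δ^tp_{Ÿ_N} := Π^tp_{Ÿ_N} ∩ Δ^tp_X` (p. 20). [cite: MochizukiEtTh2009, §1 p.17] -/
def DtpYddN (N : ℕ+) : Subgroup D.PiTemp := D.GtpYddN N ⊓ D.DeltaTemp

/-- `q̈ := q_X^{1/2} ∈ K̈` under its printed name (p. 17; the variable of `ClassicalTheta.thetaDdot`).
[cite: MochizukiEtTh2009, §1 p.17] -/
abbrev qdd : PadicAlgCl p := D.sqrtqX

/-- `O^×_K̈`: the elements of `K̈ ⊆ ℚ̄_p` of `p`-adic absolute value `1` (p. 21 "`O^×_K̈ · η̈^Θ`"), as a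
subgroup of `K̈^×`. [cite: MochizukiEtTh2009, §1 p.17] -/
def unitsOKdd : Subgroup (↥D.Kdd)ˣ where
  carrier := {u | ‖((u : D.Kdd) : PadicAlgCl p)‖ = 1}
  one_mem' := by simp
  mul_mem' {a b} ha hb := by
    simp only [Set.mem_setOf_eq, Units.val_mul, IntermediateField.coe_mul, norm_mul] at ha hb ⊢
    rw [ha, hb, mul_one]
  inv_mem' {a} ha := by
    simp only [Set.mem_setOf_eq] at ha ⊢
    have h : ((↑(a⁻¹ : (↥D.Kdd)ˣ) : D.Kdd) : PadicAlgCl p) = (((a : D.Kdd) : PadicAlgCl p))⁻¹ := by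
      rw [Units.val_inv_eq_inv_val]; push_cast; rfl
    rw [h, norm_inv, ha, inv_one]

/-- `O^×_K`: the elements of `K` of absolute value `1` ("well-defined up to an `O^×_K`-multiple",
p. 15), as a subgroup of `K^×`. [cite: MochizukiEtTh2009, §1 p.15] -/
def unitsOK : Subgroup (↥D.K)ˣ where
  carrier := {u | ‖((u : D.K) : PadicAlgCl p)‖ = 1}
  one_mem' := by simp
  mul_mem' {a b} ha hb := by
    simp only [Set.mem_setOf_eq, Units.val_mul, IntermediateField.coe_mul, norm_mul] at ha hb ⊢
    rw [ha, hb, mul_one]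
  inv_mem' {a} ha := by
    simp only [Set.mem_setOf_eq] at ha ⊢
    have h : ((↑(a⁻¹ : (↥D.K)ˣ) : D.K) : PadicAlgCl p) = (((a : D.K) : PadicAlgCl p))⁻¹ := by
      rw [Units.val_inv_eq_inv_val]; push_cast; rfl
    rw [h, norm_inv, ha, inv_one]

/-! ### Origin predicate (vacuity guard) -/

/-- **`D` comes from the setting of [EtTh] §1** — the hypothesis structure carried by named facts about
THE §1 objects (vacuity guard; see the review of p404211). It records the printed, statable
hypotheses that make the group theory non-degenerate: "`Δ_X` is a profinite free group on 2
generators" (p. 12) and `q̈ ∈` the maximal ideal. What it cannot state (no construction of André's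
tempered `π₁` exists in the tree): that `Π^tp_X` IS the tempered fundamental group of an actual
once-punctured elliptic curve — consumers needing a closed fact use the origin-predicate parameter of
the L3 interface (`SemiGraphs.TemperedPiOrigin` / the `TemperedCurve` boundary, TODO-merge: L3) in
the shape `∀ D, Origin D → …`. [cite: MochizukiEtTh2009, §1 p.12] -/
structure IsEtThOrigin (D : ThetaSetting p) : Prop where
  /-- "`Δ_X` is a profinite free group on 2 generators" (p. 12). -/
  deltaHat_free : IsFreeProfiniteOnTwo D.DeltaHat
  /-- `Δ_Θ ≠ 1` (it is `≅ Ẑ(1)`, p. 12): the theta quotient is genuinely non-abelian data. -/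
  deltaTheta_ne_bot : D.DeltaTheta ≠ ⊥

end ThetaSetting

end Literature.AnabelianGeometry.EtaleTheta

end
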